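import Mathlib
import HarnessLib
import Summits.KontsevichZagierPeriods.Zeta5Search.DougallTerminatingGamma

/-!
# ζ(5) search — the two sides of the Carlson function for Dougall's `₅F₄` sum, at the integers (cell `pub-zeta5`, ct-1 g26)

HONEST FRAMING: systematic search; no irrationality claim unless kernel-certified.  Identities / holomorphy of special
functions; nothing here is an irrationality result; no named fact is discharged.

Bricks B5b + B5c of `HOME/ct-1/g26/VWP-BLUEPRINT.md` (§3 B5: the non-terminating Dougall sum by Carlson's theorem in the
variable `z = −h₃`).  The Carlson function is `f(z) = S(z) − G(z)` with the SERIES side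
`S(z) = Σ_μ (h₀+2μ)·Γ(h₀+μ)Γ(h₁+μ)Γ(h₂+μ)/(Γ(μ+1)Γ(h₀−h₁+1+μ)Γ(h₀−h₂+1+μ)) · (−z)_μ/(h₀+1+z)_μ` and the GAMMA side
`G(z) = Γ(h₁)Γ(h₂)Γ(h₀+1+z)Γ(h₀−h₁−h₂+1+z)/(Γ(h₀−h₁−h₂+1)Γ(h₀−h₁+1+z)Γ(h₀−h₂+1+z))` (both written out in full below — no
definitions are introduced):

* `series_side_nat` (B5b) — at `z = v ∈ ℕ` the series terminates (`(−v)_μ = 0` for `μ > v`, `rf_neg_nat_eq_zero`) and, by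
  `DougallTerminatingGamma.dougall_terminating_gamma` (B5a), `S(v) = G(v)`: the agreement at the integers Carlson's theorem needs;
* `differentiableAt_gamma_side` / `differentiableOn_gamma_side` (B5c) — `G` is holomorphic off the poles of its two numerator
  Gammas, in particular on every right half-plane `{Re z > c}` with `c ≥ −Re(h₀+1)`, `c ≥ −Re(h₀−h₁−h₂+1)` (the reciprocal
  Gammas are entire: `Complex.differentiable_one_div_Gamma`);
* `differentiableAt_series_term` — each term's `z`-dependence `(−z)_μ/(h₀+1+z)_μ` is holomorphic where the denominator block
  does not vanish (input of the `tsum` holomorphy in B5e).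
Theorems only (no new definitions).
-/

noncomputable section

namespace Summit.KontsevichZagierPeriods.Zeta5Search.DougallCarlsonSides

open Finset
open Summit.KontsevichZagierPeriods.Zeta5Search.HypergeometricWhipple (rf rf_zero rf_succ)
open Summit.KontsevichZagierPeriods.Zeta5Search.DougallTerminatingGamma

/-! ### B5b — the series side terminates at `z ∈ ℕ` and equals the Gamma side there -/

/-- `(−v)_μ = 0` for naturals `v < μ` (the block passes through `0`). -/
theorem rf_neg_nat_eq_zero {v μ : ℕ} (h : v < μ) : rf (-(v : ℂ)) μ = 0 := by
  unfold rf
  exact Finset.prod_eq_zero (mem_range.2 h) (by simp)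

/-- **B5b — the series side at `z = v ∈ ℕ`.**  The very-well-poised series with last parameter pair in Pochhammer form
terminates at `z = v` and equals the Gamma side there (Dougall's terminating sum, `dougall_terminating_gamma`). -/
theorem series_side_nat (h₀ h₁ h₂ : ℂ) (v : ℕ)
    (H0 : ∀ n : ℕ, h₀ ≠ -(n : ℂ)) (H0' : ∀ n : ℕ, h₀ / 2 ≠ -(n : ℂ)) (H1 : ∀ n : ℕ, h₁ ≠ -(n : ℂ))
    (H2 : ∀ n : ℕ, h₂ ≠ -(n : ℂ)) (H01 : ∀ n : ℕ, h₀ - h₁ + 1 ≠ -(n : ℂ)) (H02 : ∀ n : ℕ, h₀ - h₂ + 1 ≠ -(n : ℂ))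
    (H012 : ∀ n : ℕ, h₀ - h₁ - h₂ + 1 ≠ -(n : ℂ)) :
    ∑' μ : ℕ, (h₀ + 2 * μ) *
        (Complex.Gamma (h₀ + μ) * Complex.Gamma (h₁ + μ) * Complex.Gamma (h₂ + μ)) /
          (Complex.Gamma ((μ : ℂ) + 1) * Complex.Gamma (h₀ - h₁ + 1 + μ) * Complex.Gamma (h₀ - h₂ + 1 + μ)) *
        (rf (-(v : ℂ)) μ / rf (h₀ + v + 1) μ) =
      Complex.Gamma h₁ * Complex.Gamma h₂ * Complex.Gamma (h₀ + 1 + v) * Complex.Gamma (h₀ - h₁ - h₂ + 1 + v) /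
        (Complex.Gamma (h₀ - h₁ - h₂ + 1) * Complex.Gamma (h₀ - h₁ + 1 + v) * Complex.Gamma (h₀ - h₂ + 1 + v)) := by
  rw [tsum_eq_sum (s := range (v + 1))
    (fun μ hμ => by rw [rf_neg_nat_eq_zero (by simpa using hμ), zero_div, mul_zero])]
  exact dougall_terminating_gamma h₀ h₁ h₂ v H0 H0' H1 H2 H01 H02 H012

/-! ### B5c — the Gamma side is holomorphic off its poles -/

/-- **B5c — holomorphy of the Gamma side** at every `z` where its two numerator Gammas have no pole
(`h₀+1+z, h₀−h₁−h₂+1+z ∉ −ℕ`); the denominator Gammas enter through the entire function `1/Γ`. -/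
theorem differentiableAt_gamma_side (h₀ h₁ h₂ : ℂ) {z : ℂ} (hz1 : ∀ n : ℕ, h₀ + 1 + z ≠ -(n : ℂ))
    (hz2 : ∀ n : ℕ, h₀ - h₁ - h₂ + 1 + z ≠ -(n : ℂ)) :
    DifferentiableAt ℂ (fun z : ℂ => Complex.Gamma h₁ * Complex.Gamma h₂ * Complex.Gamma (h₀ + 1 + z) *
        Complex.Gamma (h₀ - h₁ - h₂ + 1 + z) /
        (Complex.Gamma (h₀ - h₁ - h₂ + 1) * Complex.Gamma (h₀ - h₁ + 1 + z) * Complex.Gamma (h₀ - h₂ + 1 + z))) z := by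
  have e : (fun z : ℂ => Complex.Gamma h₁ * Complex.Gamma h₂ * Complex.Gamma (h₀ + 1 + z) *
        Complex.Gamma (h₀ - h₁ - h₂ + 1 + z) /
        (Complex.Gamma (h₀ - h₁ - h₂ + 1) * Complex.Gamma (h₀ - h₁ + 1 + z) * Complex.Gamma (h₀ - h₂ + 1 + z))) =
      fun z : ℂ => (Complex.Gamma h₁ * Complex.Gamma h₂ * (Complex.Gamma (h₀ - h₁ - h₂ + 1))⁻¹) *
        (Complex.Gamma (h₀ + 1 + z) * Complex.Gamma (h₀ - h₁ - h₂ + 1 + z) *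
          ((Complex.Gamma (h₀ - h₁ + 1 + z))⁻¹ * (Complex.Gamma (h₀ - h₂ + 1 + z))⁻¹)) := by
    funext z; ring
  rw [e]
  have d1 : DifferentiableAt ℂ (fun z : ℂ => Complex.Gamma (h₀ + 1 + z)) z :=
    (Complex.differentiableAt_Gamma _ (fun m => hz1 m)).comp z (by fun_prop)
  have d2 : DifferentiableAt ℂ (fun z : ℂ => Complex.Gamma (h₀ - h₁ - h₂ + 1 + z)) z :=
    (Complex.differentiableAt_Gamma _ (fun m => hz2 m)).comp z (by fun_prop)
  have d3 : DifferentiableAt ℂ (fun z : ℂ => (Complex.Gamma (h₀ - h₁ + 1 + z))⁻¹) z :=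
    DifferentiableAt.comp (g := fun s : ℂ => (Complex.Gamma s)⁻¹) (f := fun z : ℂ => h₀ - h₁ + 1 + z) z
      Complex.differentiable_one_div_Gamma.differentiableAt (by fun_prop)
  have d4 : DifferentiableAt ℂ (fun z : ℂ => (Complex.Gamma (h₀ - h₂ + 1 + z))⁻¹) z :=
    DifferentiableAt.comp (g := fun s : ℂ => (Complex.Gamma s)⁻¹) (f := fun z : ℂ => h₀ - h₂ + 1 + z) z
      Complex.differentiable_one_div_Gamma.differentiableAt (by fun_prop)
  exact ((d1.mul d2).mul (d3.mul d4)).const_mul _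

/-- **B5c — the Gamma side is holomorphic on every right half-plane clear of its poles**: for real `c` with
`c ≥ −Re(h₀+1)` and `c ≥ −Re(h₀−h₁−h₂+1)`, on `{z | c < Re z}`. -/
theorem differentiableOn_gamma_side (h₀ h₁ h₂ : ℂ) {c : ℝ} (hc1 : -(h₀ + 1).re ≤ c) (hc2 : -(h₀ - h₁ - h₂ + 1).re ≤ c) :
    DifferentiableOn ℂ (fun z : ℂ => Complex.Gamma h₁ * Complex.Gamma h₂ * Complex.Gamma (h₀ + 1 + z) *
        Complex.Gamma (h₀ - h₁ - h₂ + 1 + z) /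
        (Complex.Gamma (h₀ - h₁ - h₂ + 1) * Complex.Gamma (h₀ - h₁ + 1 + z) * Complex.Gamma (h₀ - h₂ + 1 + z)))
      {z : ℂ | c < z.re} := by
  intro z hz
  simp only [Complex.add_re, Complex.sub_re, Complex.one_re] at hc1 hc2
  refine (differentiableAt_gamma_side h₀ h₁ h₂ ?_ ?_).differentiableWithinAt
  · intro n h
    have := congrArg Complex.re h
    simp at this
    have hz' : c < z.re := hz
    linarith [n.cast_nonneg (α := ℝ)]
  · intro n h
    have := congrArg Complex.re h
    simp at this
    have hz' : c < z.re := hz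
    linarith [n.cast_nonneg (α := ℝ)]

/-! ### The `z`-dependence of the series terms -/

/-- `z ↦ (x + z)_μ` is a polynomial map, hence holomorphic. -/
theorem differentiable_rf_add (x : ℂ) (μ : ℕ) : Differentiable ℂ fun z : ℂ => rf (x + z) μ := by
  induction μ with
  | zero => simp [rf_zero]
  | succ μ ih =>
    simp only [rf_succ]
    exact ih.mul (by fun_prop)

/-- `z ↦ (−z)_μ` is holomorphic. -/
theorem differentiable_rf_neg (μ : ℕ) : Differentiable ℂ fun z : ℂ => rf (-z) μ := by
  induction μ with
  | zero => simp [rf_zero]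
  | succ μ ih =>
    simp only [rf_succ]
    exact ih.mul (by fun_prop)

/-- **The series term's `z`-factor `(−z)_μ/(h₀+1+z)_μ` is holomorphic wherever the denominator block does not vanish**
(e.g. on `Re z > −Re(h₀+1)`). -/
theorem differentiableAt_series_term (h₀ : ℂ) (μ : ℕ) {z : ℂ} (hz : rf (h₀ + 1 + z) μ ≠ 0) :
    DifferentiableAt ℂ (fun z : ℂ => rf (-z) μ / rf (h₀ + 1 + z) μ) z :=
  ((differentiable_rf_neg μ).differentiableAt).div ((differentiable_rf_add (h₀ + 1) μ).differentiableAt) hz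

/-- On the half-plane `Re z > −Re(h₀+1)` the denominator block `(h₀+1+z)_μ` does not vanish. -/
theorem rf_denominator_ne_zero (h₀ : ℂ) (μ : ℕ) {z : ℂ} (hz : -(h₀ + 1).re < z.re) : rf (h₀ + 1 + z) μ ≠ 0 := by
  refine rf_ne_zero (fun n h => ?_) μ
  have := congrArg Complex.re h
  simp at this
  simp at hz
  linarith [n.cast_nonneg (α := ℝ)]

end Summit.KontsevichZagierPeriods.Zeta5Search.DougallCarlsonSides

end
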